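import Summits.QuantumFields.YangMills.Theorems.LangevinControlUVFemtoCurvatureSkewnessCRatioTransportDefsD

/-!
# Route `LangevinControlUV`, crux `FemtoCurvatureSkewnessC` (stmt-QuantumFields-16205), line `ratio-transport`: vocabulary (E) —
# the fixed-coupling transports in RATE-FREE (qualitative) form

Lead `prover-line-stmt-QuantumFields-16205-c2-0` (line lead, cycle 3, 2026-08-16), companion (E) of the route-posited vocabulary files
`…CRatioTransportDefs.lean` (p121740), `…DefsB.lean` (p123565), `…DefsC.lean` (p125065), `…DefsD.lean` (p126481).  Route-posited
`def … : Prop`s only; NOTHING is asserted; none is a literature fact; none restates the crux.  A separate file (rather than an append)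
so that landing it rebuilds nothing under the registered skeleton v4.1.

## Why (reshape v4.1 → v4.2 of the stubs E_v and E_s: no rates anywhere)

Reading the landed M-adic two-ended descent `ratioFloor_of_twoEnded` (`…CMadicDescent.lean`, p126586) clause by clause shows that the
two fixed-coupling transports are consumed only QUALITATIVELY:

* E_v `VolumeTransport r a₀` (Lipschitz in the box with the rate `C_V (n/L')⁴ (L − L')/L'`) is used (V1) once, to round the box
  `L ↦ M^k ⌊L/M^k⌋` — a RELATIVE change of the box by less than `1/L₀ ≤ 1/(8 N₀)` — and (V2) through `vol_chain`, to shrink the aspect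
  ratio of the box to `K₀` at a cost `2 C_V K₀⁻⁴`.  What is needed is exactly (i) a MODULUS of continuity of the ratio in `log L`
  (`VolumeModulus`: `∀ ε ∃ η, L' ≤ L ≤ (1+η) L' ⇒ |u(L) − u(L')| ≤ ε`) and (ii) a large-aspect-ratio CAUCHY property
  (`VolumeCauchy`: `∀ ε ∃ K, K n ≤ L' ≤ L ⇒ |u(L) − u(L')| ≤ ε`), both in the femto boxes of `a₀`, both without any rate.
* E_s `SeparationTransport r a₀` (`C_S/n`-Lipschitz in the separation) is used once, through `sep_chain`, to move the separation
  `M^k n₀ ↦ M^k n₀ + d` with `d < M^k` — a RELATIVE change by less than `1/n₀ ≤ 1/N₀`.  What is needed is exactly a MODULUS of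
  continuity in `log n` (`SeparationModulus`: `∀ ε ∃ η, n ≤ n' ≤ (1+η) n ⇒ |u(n') − u(n)| ≤ ε`), without any rate.

After this reshape EVERY transport of the line is a convergence statement — two-ended Cauchy along the `M`-adic RG chains
(`CutoffTwoEnded`, v4.1), continuity of the femto values of `u` in log-box and log-separation, existence of the large-aspect-ratio
limit — i.e. the deliverable of a continuum-LIMIT engine (existence and continuity of limits of renormalised expectations), not of an
effective-action engine with error rates.  The v4.1 stubs imply the v4.2 stubs and the descent closes from the v4.2 stubs: both
kernel-checked in the companion proof file `LangevinControlUVFemtoCurvatureSkewnessCQualitativeDescent.lean` (this lead):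
`volumeEngineQ_of_volumeEngine`, `separationEngineQ_of_separationEngine`, `ratioFloor_of_twoEndedQ`,
`femtoCurvatureSkewnessC_of_enginesQ : CutoffEngineTE → VolumeEngineQ → SeparationEngineQ → Anchors → FemtoCurvatureSkewnessC`.

Also typed here, for the planners: `RatioTransportEngineQ`, the conjunction of the three sign-free engine stubs in their weakest typed
forms (E_c two-ended ∧ E_v qualitative ∧ E_s qualitative) over the hypothesis data `(G, r, a₀)` — ONE promotable physics statement
(`femtoCurvatureSkewnessC_of_engineQ : RatioTransportEngineQ → Anchors → FemtoCurvatureSkewnessC` in the companion file).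
-/

set_option autoImplicit false

noncomputable section

namespace Summit.QuantumFields.YangMills.Cruxes.FemtoCurvatureSkewnessC.RatioTransport

open MeasureTheory Filter Topology
open Literature.MathematicalPhysics.QuantumFieldTheory
open Summit.QuantumFields.YangMills.Theorems.FemtoCurvatureSkewness.Negative (TwoPointPackage)

section Qualitative

variable {G : Type} [Group G] [TopologicalSpace G] [IsTopologicalGroup G] [CompactSpace G]
  [MeasurableSpace G] [BorelSpace G]

/-- **(T_v, modulus form) Volume modulus at fixed coupling** (sign-free, rate-free): for every `ε > 0` there is a relative tolerance
`η > 0` such that, in the femto boxes of `a`, enlarging the torus from `L'` to any `L ≤ (1 + η) L'` (`8n ≤ L'`) at the same `β` and `n`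
moves the tree-normalised skewness ratio by at most `ε` — uniform continuity of `u` in `log L`. -/
def VolumeModulus (r : LatticeRep G) (a : ℝ → ℝ) : Prop :=
  ∀ ε : ℝ, 0 < ε → ∃ (β_v ℓ_v η : ℝ), 0 < ℓ_v ∧ 0 < η ∧
    ∀ (L L' : ℕ) [NeZero L] [NeZero L'] (β : ℝ) (n : ℕ), β_v ≤ β → (L : ℝ) * a β ≤ ℓ_v →
      1 ≤ n → 8 * n ≤ L' → L' ≤ L → (L : ℝ) ≤ (1 + η) * L' →
        |skewRatioT r L β n - skewRatioT r L' β n| ≤ ε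

/-- **(T_v, Cauchy form) Large-aspect-ratio Cauchy property at fixed coupling** (sign-free, rate-free): for every `ε > 0` there is an
aspect ratio `K ≥ 8` such that, in the femto boxes of `a`, any two tori `K n ≤ L' ≤ L` at the same `β` and `n` have ratios within `ε`
— the ratio has a limit as the box outgrows the separation, uniformly. -/
def VolumeCauchy (r : LatticeRep G) (a : ℝ → ℝ) : Prop :=
  ∀ ε : ℝ, 0 < ε → ∃ (β_v ℓ_v : ℝ) (K : ℕ), 0 < ℓ_v ∧ 8 ≤ K ∧
    ∀ (L L' : ℕ) [NeZero L] [NeZero L'] (β : ℝ) (n : ℕ), β_v ≤ β → (L : ℝ) * a β ≤ ℓ_v →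
      1 ≤ n → K * n ≤ L' → L' ≤ L →
        |skewRatioT r L β n - skewRatioT r L' β n| ≤ ε

/-- **(T_s, modulus form) Separation modulus at fixed `(L, β)`** (sign-free, rate-free): for every `ε > 0` there is a relative
tolerance `η > 0` such that, in the femto boxes of `a`, increasing the separation from `n` to any `n' ≤ (1 + η) n` (`8n' ≤ L`) moves
the ratio by at most `ε` — uniform continuity of `u` in `log n`. -/
def SeparationModulus (r : LatticeRep G) (a : ℝ → ℝ) : Prop :=
  ∀ ε : ℝ, 0 < ε → ∃ (β_s ℓ_s η : ℝ), 0 < ℓ_s ∧ 0 < η ∧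
    ∀ (L : ℕ) [NeZero L] (β : ℝ) (n n' : ℕ), β_s ≤ β → (L : ℝ) * a β ≤ ℓ_s →
      1 ≤ n → n ≤ n' → (n' : ℝ) ≤ (1 + η) * n → 8 * n' ≤ L →
        |skewRatioT r L β n' - skewRatioT r L β n| ≤ ε

end Qualitative

/-- **Stub E_v (qualitative form) `VolumeEngineQ`:** for compact simple `G`, any `r` and any continuous package map `a₀`, the volume
modulus and the large-aspect-ratio Cauchy property of the ratio in `a₀`'s femto boxes.  Implied by v4.1's `VolumeEngine`
(`volumeEngineQ_of_volumeEngine`). -/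
def VolumeEngineQ : Prop :=
  ∀ (G : Type) [Group G] [TopologicalSpace G] [IsTopologicalGroup G] [CompactSpace G]
    [MeasurableSpace G] [BorelSpace G], IsCompactSimpleLieGroup G →
    ∀ (r : LatticeRep G) (a₀ : ℝ → ℝ), Continuous a₀ → TwoPointPackage r a₀ → VolumeModulus r a₀ ∧ VolumeCauchy r a₀

/-- **Stub E_s (qualitative form) `SeparationEngineQ`:** for compact simple `G`, any `r` and any continuous package map `a₀`, the
separation modulus of the ratio in `a₀`'s femto boxes.  Implied by v4.1's `SeparationEngine` (`separationEngineQ_of_separationEngine`). -/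
def SeparationEngineQ : Prop :=
  ∀ (G : Type) [Group G] [TopologicalSpace G] [IsTopologicalGroup G] [CompactSpace G]
    [MeasurableSpace G] [BorelSpace G], IsCompactSimpleLieGroup G →
    ∀ (r : LatticeRep G) (a₀ : ℝ → ℝ), Continuous a₀ → TwoPointPackage r a₀ → SeparationModulus r a₀

/-- **The three sign-free engine stubs of the line in their weakest typed forms, as ONE statement** (for the planners: the promotable
physics content of line `ratio-transport` besides the anchors): for compact simple `G`, any `r` and any continuous package map `a₀` —
(E_c) some block factor `M ≥ 2` and some continuous positive chain map `a` dominated by `a₀` with the two-ended cutoff transport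
`CutoffTwoEnded r a M`; (E_v) the volume modulus and the large-aspect-ratio Cauchy property in `a₀`'s boxes; (E_s) the separation modulus
in `a₀`'s boxes.  `RatioTransportEngineQ ↔ CutoffEngineTE ∧ VolumeEngineQ ∧ SeparationEngineQ` (`engineQ_iff`). -/
def RatioTransportEngineQ : Prop :=
  ∀ (G : Type) [Group G] [TopologicalSpace G] [IsTopologicalGroup G] [CompactSpace G]
    [MeasurableSpace G] [BorelSpace G], IsCompactSimpleLieGroup G →
    ∀ (r : LatticeRep G) (a₀ : ℝ → ℝ), Continuous a₀ → TwoPointPackage r a₀ →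
      (∃ M : ℕ, 2 ≤ M ∧ ∃ a : ℝ → ℝ, Continuous a ∧ (∀ β, 0 < a β) ∧ Dominated a a₀ ∧ CutoffTwoEnded r a M) ∧
      (VolumeModulus r a₀ ∧ VolumeCauchy r a₀) ∧ SeparationModulus r a₀

/-! ## Registered stub signatures of skeleton v4.2 (`Cruxes/FemtoCurvatureSkewnessC/Lines/Sketch.lean`)

Abbreviations only (`theorem stub_<name> : Sig.stub_<name>` in the skeleton); `Sig.stub_cutoffEngineTE` (file `…DefsD.lean`) and
`Sig.stub_anchors` (file `…Defs.lean`) are unchanged. -/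

/-- Registered signature of stub E_v in qualitative form (skeleton v4.2). -/
def Sig.stub_volumeEngineQ : Prop := VolumeEngineQ

/-- Registered signature of stub E_s in qualitative form (skeleton v4.2). -/
def Sig.stub_separationEngineQ : Prop := SeparationEngineQ

end Summit.QuantumFields.YangMills.Cruxes.FemtoCurvatureSkewnessC.RatioTransport

end
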